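import Literature.Probability.Percolation.InterfaceScalingLimitDiscretised
import Literature.Probability.Percolation.InterfaceCurves
import HarnessLib
import Summits.CriticalPhenomena.CardyFormulaZ2.Theorems.SLE6LimitZ2AllDiscretisations

/-!
# `InterfaceCurves` and `InterfaceScalingLimit*` define the same interfaces (bridge lemmas)

`Literature/Probability/Percolation/InterfaceCurves.lean` is the fact-free home (imports
`RandomPlanarGeometry.Curve`/`CurveSpace` + `LatticeModels.DobrushinDiscretisation` only) of the
percolation-interface vocabulary `dobrushinData`, `reverseCurve`, `orientCurve`, `triInterface`,
`bondInterface` (of `InterfaceScalingLimit.lean`) and `bondInterfaceIn`,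
`zdDiscretisationFamily_dobrushinData_iff` (of `InterfaceScalingLimitDiscretised.lean`),
reproduced verbatim in the sub-namespace `Interface` (definition item
`defn-ZdDiscretisationFamily-2`, route repair of the `CardyFormulaZ2` routes). This file, which
imports both sides, records once that the two copies are the same objects (`rfl`), and spells
out the named statements of `InterfaceScalingLimit*` — the OPEN CONJECTURES `SLE6LimitZ2`,
`SLE6LimitZ2AllDiscretisations` and the facts `isTightLaws_map_bondInterface`,
`aemeasurable_bondInterface` — over the fact-free vocabulary (`Iff.rfl`): these unfoldings are
the forms a route file states inline while importing only fact-free modules, and the lemmas here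
convert in both directions. Nothing is defined here, no fact is restated as a definition, and no
route needs to import this file.

In this module both the real constants `Literature.Probability.Percolation.bondInterface`, …
and the aliases of the same names exported by `InterfaceCurves` are visible: fully-qualified
names denote the real constants, the copies are reached as `Interface.…`, and the short names
are ambiguous (so none is used unqualified).

* `Interface.dobrushinData_eq_dobrushinData`, `Interface.reverseCurve_eq_reverseCurve`,
  `Interface.orientCurve_eq_orientCurve`, `Interface.triInterface_eq_triInterface`,
  `Interface.bondInterface_eq_bondInterface`, `Interface.bondInterfaceIn_eq_bondInterfaceIn`;
* `sle6LimitZ2AllDiscretisations_iff_interface`, `sle6LimitZ2_iff_interface`,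
  `isTightLaws_map_bondInterface_iff_interface`, `aemeasurable_bondInterface_iff_interface`;
* `convergesInLawToSLE_interfaceBondInterface_of_family` — the family form yields the
  canonical-data conclusion wherever the canonical data form a discretisation family.

## References

* S. Smirnov, *Towards conformal invariance of 2D lattice models*, Proc. ICM 2006, Vol. II,
  §2.1, §2.3 Conj. 4. [Smirnov2007ICM]
* M. Aizenman, A. Burchard, Duke Math. J. 99 (1999), Thms 1.1–1.2. [AizenmanBurchard1999]
-/

/-! ### The fact-free interface vocabulary agrees with `InterfaceScalingLimit*` -/

namespace Literature.Probability.Percolation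

open MeasureTheory Filter Topology
open LatticeModels RandomPlanarGeometry
open scoped unitInterval

/-- The two copies of the canonical discrete Dobrushin data agree (same body). [folklore] -/
theorem Interface.dobrushinData_eq_dobrushinData :
    @Interface.dobrushinData = @Literature.Probability.Percolation.dobrushinData := rfl

/-- The two copies of time reversal agree (same body). [folklore] -/
theorem Interface.reverseCurve_eq_reverseCurve {E : Type*} [TopologicalSpace E] (γ : C(I, E)) :
    Interface.reverseCurve γ = Literature.Probability.Percolation.reverseCurve γ := rfl

/-- The two copies of the endpoint rule agree (same body). [folklore] -/
theorem Interface.orientCurve_eq_orientCurve :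
    @Interface.orientCurve = @Literature.Probability.Percolation.orientCurve := rfl

/-- The two copies of the triangular interface agree (same body). [folklore] -/
theorem Interface.triInterface_eq_triInterface :
    @Interface.triInterface = @Literature.Probability.Percolation.triInterface := rfl

/-- The two copies of the canonical bond interface agree (same body). [folklore] -/
theorem Interface.bondInterface_eq_bondInterface :
    @Interface.bondInterface = @Literature.Probability.Percolation.bondInterface := rfl

/-- The two copies of the bond interface in a general discrete Dobrushin domain agree (same
body). [folklore] -/
theorem Interface.bondInterfaceIn_eq_bondInterfaceIn :
    @Interface.bondInterfaceIn = @Literature.Probability.Percolation.bondInterfaceIn := rfl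

/-- **The open conjecture `SLE6LimitZ2AllDiscretisations`, unfolded over the fact-free
vocabulary** (`ZdDiscretisationFamily` of `DobrushinDiscretisation.lean`, `bondInterfaceIn` of
`InterfaceCurves.lean`): this is the family form a route file states inline as its SLE₆ crux
while importing only fact-free modules; the equivalence is definitional. (Smirnov, ICM 2006,
§2.3, Conj. 4 at `q = 1`, for the statement.) [folklore] -/
theorem sle6LimitZ2AllDiscretisations_iff_interface :
    Summit.CriticalPhenomena.CardyFormulaZ2.SLE6LimitZ2AllDiscretisations ↔
      ∀ (D : DobrushinDomain) (E : ℝ → DiscreteDobrushin), ZdDiscretisationFamily D E →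
        ConvergesInLawToSLE 6 D (Ωδ := fun _ ↦ BondConfig (Site 2))
          (fun δ ↦ Interface.bondInterfaceIn D (E δ)) fun _ ↦ bondPercolation (zdGraph 2) half :=
  Iff.rfl

/-- **The open conjecture `SLE6LimitZ2` (canonical data, admissibility guard), unfolded over the
fact-free vocabulary** (`Interface.dobrushinData`, `Interface.bondInterface`); definitional.
(Smirnov, ICM 2006, §2.3, Conj. 4 at `q = 1`, for the statement.) [folklore] -/
theorem sle6LimitZ2_iff_interface :
    SLE6LimitZ2 ↔
      ∀ D : DobrushinDomain,
        (∀ᶠ δ in 𝓝[>] (0 : ℝ), (Interface.dobrushinData D δ).IsZdAdmissible) →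
          ConvergesInLawToSLE 6 D (Ωδ := fun _ ↦ BondConfig (Site 2))
            (Interface.bondInterface D) fun _ ↦ bondPercolation (zdGraph 2) half :=
  Iff.rfl

/-- The tightness fact `isTightLaws_map_bondInterface` (Aizenman–Burchard), unfolded over the
fact-free vocabulary; definitional. [folklore] -/
theorem isTightLaws_map_bondInterface_iff_interface :
    isTightLaws_map_bondInterface ↔
      ∀ D : DobrushinDomain,
        (∀ᶠ δ in 𝓝[>] (0 : ℝ), (Interface.dobrushinData D δ).IsZdAdmissible) →
          IsTightLaws fun δ ↦ (bondPercolation (zdGraph 2) half).map (Interface.bondInterface D δ) :=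
  Iff.rfl

/-- The measurability fact `aemeasurable_bondInterface`, unfolded over the fact-free
vocabulary; definitional. [folklore] -/
theorem aemeasurable_bondInterface_iff_interface :
    aemeasurable_bondInterface ↔
      ∀ (D : DobrushinDomain) (δ : ℝ),
        AEMeasurable (Interface.bondInterface D δ) (bondPercolation (zdGraph 2) half) :=
  Iff.rfl

/-- Consequently the corrected conjecture, in its fact-free family form, yields the conclusion of
`SLE6LimitZ2` on every Dobrushin domain whose canonical data form a discretisation family
(`convergesInLawToSLE_bondInterface_of_allDiscretisations`, transported). [folklore] -/
theorem convergesInLawToSLE_interfaceBondInterface_of_family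
    (h : ∀ (D : DobrushinDomain) (E : ℝ → DiscreteDobrushin), ZdDiscretisationFamily D E →
        ConvergesInLawToSLE 6 D (Ωδ := fun _ ↦ BondConfig (Site 2))
          (fun δ ↦ Interface.bondInterfaceIn D (E δ)) fun _ ↦ bondPercolation (zdGraph 2) half)
    (D : DobrushinDomain) (hD : ZdDiscretisationFamily D (Interface.dobrushinData D)) :
    ConvergesInLawToSLE 6 D (Ωδ := fun _ ↦ BondConfig (Site 2)) (Interface.bondInterface D)
      fun _ ↦ bondPercolation (zdGraph 2) half :=
  h D (Interface.dobrushinData D) hD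

end Literature.Probability.Percolation
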